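import Literature.AnabelianGeometry.SemiGraphs.Pullback

/-!
# A criterion for embeddings of semi-graphs ([SemiAnbd] §1, p. 12)

Mochizuki, *Semi-graphs of anabelioids*, Publ. RIMS **42** (2006) 221–322, §1, author's manuscript
p. 12 [cite: MochizukiSemiAnbd2006, §1 p.12]: an *embedding* is a morphism inducing an isomorphism
onto a sub-semi-graph, whose coincidence maps are, by conditions (b), (c) of p. 12, the restrictions
of those of the ambient semi-graph.  Hence a morphism `ψ : X → Y` is an embedding as soon as it is
injective on vertices and on edges AND reflects abutment to vertices of `X`: whenever the image of a
branch `c` abuts to the image of a vertex `v`, already `c` abuts to `v` (for graphs `X` the last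
condition is automatic).  This file proves that criterion, `SemiGraph.isEmbedding_of_injective`, used
by the proofs of Lemma 1.5 and Theorem 1.2 (proof-only; no definitions: the sub-semi-graph and the
isomorphism are built inside the proof).
-/

namespace Literature.AnabelianGeometry.SemiGraphs

namespace SemiGraph

open CategoryTheory

universe u

/-- **Embedding criterion.**  A morphism of semi-graphs which is injective on vertices and on edges
and reflects abutment (`ψ(c)` abuts to `ψ(v)` only if `c` abuts to `v`) is an embedding: it induces an
isomorphism onto the sub-semi-graph formed by its image ([SemiAnbd] §1 p. 12, conditions (a)–(c)).
[cite: MochizukiSemiAnbd2006, §1 p.12] -/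
theorem isEmbedding_of_injective {X Y : SemiGraph.{u}} (ψ : X ⟶ Y)
    (hv : Function.Injective ψ.vertexMap) (he : Function.Injective ψ.edgeMap)
    (hab : ∀ (c : X.Branch) (v : X.Vertex),
      Y.abuts (ψ.branchMap c) = some (ψ.vertexMap v) → X.abuts c = some v) :
    IsEmbedding ψ := by
  classical
  -- the image sub-semi-graph
  let K : Y.Subgraph := { verts := Set.range ψ.vertexMap, edges := Set.range ψ.edgeMap }
  -- branches of `X` are determined by their images (injectivity on edges and on each edge)
  have hb : Function.Injective ψ.branchMap := fun c₁ c₂ h =>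
    ψ.branchMap_injOn c₁ c₂ (he (by rw [← ψ.edgeOf_branchMap, ← ψ.edgeOf_branchMap, h])) h
  -- `X → (image)`
  let toK : X ⟶ K.toSemiGraph :=
    { vertexMap := fun v => ⟨ψ.vertexMap v, v, rfl⟩
      edgeMap := fun e => ⟨ψ.edgeMap e, e, rfl⟩
      branchMap := fun c => ⟨ψ.branchMap c, X.edgeOf c, (ψ.edgeOf_branchMap c).symm⟩
      edgeOf_branchMap := fun c => Subtype.ext (ψ.edgeOf_branchMap c)
      branchMap_injOn := fun c₁ c₂ _ h => hb (congrArg Subtype.val h)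
      abuts_branchMap := by
        intro c v h
        change (Y.abuts (ψ.branchMap c)).pbind _ = _
        simp only [ψ.abuts_branchMap c v h, Option.pbind_some]
        exact dif_pos ⟨v, rfl⟩ }
  -- preimages (by choice; unique by injectivity)
  have exb : ∀ z : K.toSemiGraph.Branch, ∃ c : X.Branch,
      X.edgeOf c = Classical.choose z.2 ∧ ψ.branchMap c = z.1 := fun z =>
    Hom.exists_branchMap_eq ψ _ z.1 (Classical.choose_spec z.2).symm
  let ofK : K.toSemiGraph ⟶ X :=
    { vertexMap := fun y => Classical.choose y.2
      edgeMap := fun x => Classical.choose x.2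
      branchMap := fun z => Classical.choose (exb z)
      edgeOf_branchMap := fun z => (Classical.choose_spec (exb z)).1
      branchMap_injOn := by
        intro z₁ z₂ _ h
        apply Subtype.ext
        rw [← (Classical.choose_spec (exb z₁)).2, ← (Classical.choose_spec (exb z₂)).2, h]
      abuts_branchMap := by
        intro z y h
        change (Y.abuts z.1).pbind _ = some y at h
        apply hab
        rw [(Classical.choose_spec (exb z)).2, Classical.choose_spec y.2]
        cases hz : Y.abuts z.1 with
        | none => simp [hz] at h
        | some w =>
          simp only [hz, Option.pbind_some] at h
          split_ifs at h with hw
          cases h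
          rfl }
  have h_hom_inv : toK ≫ ofK = 𝟙 X := by
    refine SemiGraph.hom_ext _ _ (funext fun v => ?_) (funext fun e => ?_) (funext fun c => ?_)
    · exact hv (Classical.choose_spec (⟨v, rfl⟩ : ψ.vertexMap v ∈ Set.range ψ.vertexMap))
    · exact he (Classical.choose_spec (⟨e, rfl⟩ : ψ.edgeMap e ∈ Set.range ψ.edgeMap))
    · exact hb (Classical.choose_spec (exb (toK.branchMap c))).2
  have h_inv_hom : ofK ≫ toK = 𝟙 K.toSemiGraph := by
    refine SemiGraph.hom_ext _ _ (funext fun y => ?_) (funext fun x => ?_) (funext fun z => ?_)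
    · exact Subtype.ext (Classical.choose_spec y.2)
    · exact Subtype.ext (Classical.choose_spec x.2)
    · exact Subtype.ext (Classical.choose_spec (exb z)).2
  let iso : X ≅ K.toSemiGraph := ⟨toK, ofK, h_hom_inv, h_inv_hom⟩
  exact ⟨K, iso, SemiGraph.hom_ext _ _ rfl rfl rfl⟩

/-- For a graph `X` (every branch abuts to a vertex) the abutment condition of the embedding criterion
is automatic: a morphism of semi-graphs out of a graph which is injective on vertices and on edges is
an embedding. [cite: MochizukiSemiAnbd2006, §1 p.12] -/
theorem isEmbedding_of_injective_of_isGraph {X Y : SemiGraph.{u}} (ψ : X ⟶ Y) (hX : X.IsGraph)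
    (hv : Function.Injective ψ.vertexMap) (he : Function.Injective ψ.edgeMap) : IsEmbedding ψ := by
  refine isEmbedding_of_injective ψ hv he fun c v h => ?_
  obtain ⟨v', hv'⟩ := Option.isSome_iff_exists.1 (hX.abuts_isSome c)
  rw [hv']
  have h' := ψ.abuts_branchMap c v' hv'
  rw [h] at h'
  exact congrArg some (hv (Option.some.inj h')).symm

end SemiGraph

end Literature.AnabelianGeometry.SemiGraphs
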